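import Summits.QuantumFields.BalabanUV.T4Continuum.Spine.NE4.AutonomousSchemeStable
import Summits.QuantumFields.BalabanUV.T4Continuum.Spine.NE4.KingCurrency
import Mathlib.Analysis.SpecificLimits.Normed

/-!
# Spine/NE4/AutonomousSchemeParabolic — (R54) THE PARABOLIC REGIME OF THE AUTONOMOUS ROAD: a holomorphic self-map of ONE ball WITHOUT margin whose
# orbit converges POLYNOMIALLY — King's-currency β-input (cutoff-forgetting, (R51)) HOLDS, NE4 FAILS at every geometric rate; a marginal direction
# left inside the state is exactly what separates the two currencies, and what the margin of (R53) excludes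

Cell `pub-balaban-gaps` (YM blitz G2), seat `ne4`, generation 15 (unit `pub-balaban-gaps-ne4-g15`); record `HOME/ne/NE4.md` §5 (R54).

HONEST FRAMING.  NE4 = `T4CouplingMatching.ScaleShiftRate` is NOT IN PRINT ([Balaban1987RG1] = CMP **109** (1987) p. 264 «We will investigate other properties in a
separate paper») and NOT proved.  Below: ONE explicit caricature — the parabolic Möbius self-map `z ↦ (1 + z)∕(3 − z)` of the unit disc (the Cayley picture of the translation
`w ↦ w + 1` of the right half-plane) — run through the census's hypothesis shapes; elementary complex∕real arithmetic; nothing of Bałaban's asserted or instantiated; no status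
word moves (NE4 stays DEPENDENT; spine 0∕9).  One finite T⁴; NOT ℝ⁴, NOT infinite volume, NOT a mass gap, NOT Clay.

THE POINT (fifteenth reader, third file).  (R53) split the holomorphic autonomous road in two: WITH a margin `q < 1` on a complex ball, Earle–Hamilton gives NE4's geometric
rate (`AutonomousSchemeMargin.ne4_of_strictInward`); WITHOUT margin (`q = 1`) the disc involution has NO convergence at all (`not_scaleShiftRate_invol`: the orbit oscillates).
Between the two sits the regime that matters physically — PARABOLIC dynamics: a holomorphic self-map of the ball with NO interior attracting fixed point whose orbits nevertheless
CONVERGE, polynomially, to a boundary point (Denjoy–Wolff picture).  The explicit scheme `para z = (1 + z)∕(3 − z)` (§1: holomorphic on the unit disc, maps it into itself —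
`‖1 + z‖² < ‖3 − z‖² ⟺ re z < 1` —, margin exactly `q = 1`: `sup ‖para‖ = 1`, `not_mapsTo_para_closedBall`; boundary fixed point `1` with multiplier `para′(1) = 1`) has the
orbit of the bare state `state n = n∕(n + 2)` (§2, `state_paraScheme`), so the β-family read off by `re` is `β_{k+1} = (k+1)∕(k+3)` (`paraBeta_eq`), HISTORY-INDEPENDENT and
CONVERGENT: the n-shift modulus of King's currency holds with `ω_j = 2∕(j+3) → 0` (§3 **`uniformShift_paraBeta`**, `tendsto_paraOmega`) — node U2's β-side input on KING's route
((R51)∕(R52): `UniformShift ω → 0` + memory companion, here trivially `HistLipschitz 0`) is SATISFIED —, while the scale shift is `2∕((k+3)(k+4))`, polynomial, so NE4 FAILS at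
every geometric rate (§4 **`not_scaleShiftRate_para`**) and no orbit-stability constants exist on the invariant disc (`not_orbitStability_para`).  READING.  (a) On the
autonomous road King's currency is STRICTLY WEAKER than NE4, and the gap between them is realised HOLOMORPHICALLY exactly by parabolic dynamics; (b) parabolic = a MARGINAL
direction carried INSIDE the state: the caricature is the Cayley transform of `w ↦ w + 1`, i.e. of the one-loop flow `1∕g²_{k+1} = 1∕g²_k + β` of the asymptotically free
coupling itself ([Balaban1987RG1] (0.20) p. 256) — so (R42)'s design decision to carry the marginal coupling as the PARAMETER `g` of the step `A g` (not as a state coordinate)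
is not cosmetic: with the coupling inside the state, RT is parabolic, no margin can hold on any ball ((R53)(i) would otherwise force NE4 — here visible directly:
`not_mapsTo_para_closedBall`), and the best one gets is King's rate-free input; NE4's geometric rate = hyperbolicity TRANSVERSE to the extracted marginal direction.
(c) For the spine this is harmless: King's route ((R51)) closes node U2∕U6 without NE4; NE4 PROPER is the statement that AFTER extraction nothing parabolic is left.

WHAT THIS SAYS FOR THE ROW (census (R54); classification words UNCHANGED): the three holomorphic caricatures — contraction with margin ((R53)(i) §1–§3), involution without
margin ((R53)(i) §4), parabolic without margin (this file) — exhaust the trichotomy {geometric rate ∕ no convergence ∕ convergence without rate} INSIDE the autonomous road's own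
currency, and locate King's weaker β-input ((R51)) as the parabolic case.  NOT PRINTED; nothing of Bałaban's asserted; NE4 NOT proved.
-/

noncomputable section

namespace Summit.QuantumFields.BalabanUV.T4Continuum.Spine.NE4

open Literature.MathematicalPhysics.QuantumFieldTheory.Balaban1983to89
open Literature.MathematicalPhysics.QuantumFieldTheory.Balaban1983to89.FlowStep
open Literature.MathematicalPhysics.QuantumFieldTheory.Balaban1983to89.T4CouplingMatching (ScaleShiftRate HistLipschitz)
open Literature.MathematicalPhysics.QuantumFieldTheory.Balaban1983to89.T4FlagMemory (extd extd_adm Adm)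
open Summit.QuantumFields.BalabanUV.T4Continuum.Spine.NE4.KingCurrency (UniformShift)
open Metric Set Filter Topology

namespace Markov

/-! ## §1 The parabolic self-map of the disc: holomorphic, maps the disc into itself, NO margin -/

section Para

/-- The PARABOLIC MÖBIUS SELF-MAP of the unit disc `para z = (1 + z)∕(3 − z)` — the Cayley picture of the translation `w ↦ w + 1` of the right half-plane
(`w = (1+z)∕(1−z)`); boundary fixed point `1` with multiplier `1`.  A caricature; NOT Bałaban's RT. [folklore] -/
def para (z : ℂ) : ℂ := (1 + z) / (3 - z)

/-- [bookkeeping] On the unit disc the denominator does not vanish. [folklore] -/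
theorem three_sub_ne_zero {z : ℂ} (hz : ‖z‖ < 1) : (3 : ℂ) - z ≠ 0 := by
  intro h
  have h1 : z = 3 := by linear_combination -h
  rw [h1] at hz
  norm_num at hz

/-- **THE DISC IS MAPPED INTO THE DISC**: `‖para z‖ < 1` for `‖z‖ < 1` (`‖1 + z‖² < ‖3 − z‖² ⟺ 8·re z < 8`). [folklore] -/
theorem norm_para_lt_one {z : ℂ} (hz : ‖z‖ < 1) : ‖para z‖ < 1 := by
  have hden := three_sub_ne_zero hz
  have hden' : 0 < ‖(3 : ℂ) - z‖ := norm_pos_iff.2 hden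
  rw [para, norm_div, div_lt_one hden']
  have hre : z.re < 1 := lt_of_le_of_lt (Complex.re_le_norm z) hz
  have key : ‖1 + z‖ ^ 2 < ‖(3 : ℂ) - z‖ ^ 2 := by
    rw [Complex.sq_norm, Complex.sq_norm, Complex.normSq_apply, Complex.normSq_apply]
    simp only [Complex.add_re, Complex.one_re, Complex.add_im, Complex.one_im, zero_add, Complex.sub_re, Complex.sub_im,
      Complex.re_ofNat, Complex.im_ofNat, zero_sub, mul_neg, neg_mul, neg_neg]
    nlinarith
  exact lt_of_pow_lt_pow_left₀ 2 hden'.le key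

/-- The map is complex-differentiable on the unit disc (pole at `3`). [folklore] -/
theorem differentiableOn_para : DifferentiableOn ℂ para (ball (0 : ℂ) 1) := fun _ hz =>
  (((differentiableAt_const _).add differentiableAt_id).div ((differentiableAt_const _).sub differentiableAt_id)
    (three_sub_ne_zero (mem_ball_zero_iff.1 hz))).differentiableWithinAt

/-- [bookkeeping] On real points: `para x = (1 + x)∕(3 − x)` as a real number. [folklore] -/
theorem para_ofReal (x : ℝ) : para (x : ℂ) = (((1 + x) / (3 - x) : ℝ) : ℂ) := by
  rw [para]; push_cast; ring

/-- **NO MARGIN**: for every `q < 1` some point of the disc is mapped OUTSIDE `closedBall 0 q` (real points `x ↑ 1` have `para x ↑ 1`): the scheme is a self-map of ONE ball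
with margin EXACTLY `q = 1` — (R53)(i)'s `StrictInward … 1 q` fails for every `q < 1`. [folklore] -/
theorem not_mapsTo_para_closedBall {q : ℝ} (hq : q < 1) : ¬ MapsTo para (ball (0 : ℂ) 1) (closedBall (0 : ℂ) q) := by
  intro h
  -- the real point x = (a + 1)/2 with a = max 0 ((3q − 1)/(1 + q)) lies in the disc and para x > q
  by_cases hq0 : q < 1 / 3
  · have h0 : (0 : ℂ) ∈ ball (0 : ℂ) 1 := mem_ball_self one_pos
    have := mem_closedBall_zero_iff.1 (h h0)
    rw [show para 0 = ((1 / 3 : ℝ) : ℂ) by rw [show (0 : ℂ) = ((0 : ℝ) : ℂ) by simp, para_ofReal]; norm_num,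
      Complex.norm_real, Real.norm_eq_abs, abs_of_pos (by norm_num : (0 : ℝ) < 1 / 3)] at this
    linarith
  · push Not at hq0
    set a : ℝ := (3 * q - 1) / (1 + q) with ha
    have hq1 : 0 < 1 + q := by linarith
    have ha0 : 0 ≤ a := div_nonneg (by linarith) hq1.le
    have ha1 : a < 1 := by rw [ha, div_lt_one hq1]; linarith
    set x : ℝ := (a + 1) / 2 with hx
    have hx0 : 0 ≤ x := by positivity
    have hx1 : x < 1 := by rw [hx]; linarith
    have hxa : a < x := by rw [hx]; linarith
    have hmem : (x : ℂ) ∈ ball (0 : ℂ) 1 := by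
      rw [mem_ball_zero_iff, Complex.norm_real, Real.norm_eq_abs, abs_of_nonneg hx0]; exact hx1
    have hle := mem_closedBall_zero_iff.1 (h hmem)
    have hpos : 0 < (1 + x) / (3 - x) := by
      apply div_pos <;> linarith
    rw [para_ofReal, Complex.norm_real, Real.norm_eq_abs, abs_of_pos hpos, div_le_iff₀ (by linarith)] at hle
    -- a < x ⟹ (3q − 1) < x(1 + q) ⟹ q(3 − x) < 1 + x
    have h3 : 3 * q - 1 < x * (1 + q) := by
      have := (div_lt_iff₀ hq1).1 (lt_of_le_of_lt le_rfl hxa)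
      linarith
    nlinarith

/-- The COUPLING-INDEPENDENT SCHEME «apply `para` at every step». [folklore] -/
def paraScheme : ℝ → ℂ → ℂ := fun _ z => para z

/-- [bookkeeping] The parabolic scheme keeps the open unit disc (an invariant set containing the bare state). [folklore] -/
theorem invariant_paraScheme (γ : ℝ) : Invariant paraScheme (ball (0 : ℂ) 1) γ :=
  fun _ _ _ _ hz => mem_ball_zero_iff.2 (norm_para_lt_one (mem_ball_zero_iff.1 hz))

/-- [bookkeeping] Each step is holomorphic on the disc with values in the disc — (R53)(i)'s shape with margin exactly `q = 1`. [folklore] -/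
theorem paraScheme_holo_self (g : ℝ) :
    DifferentiableOn ℂ (paraScheme g) (ball (0 : ℂ) 1) ∧ MapsTo (paraScheme g) (ball (0 : ℂ) 1) (closedBall (0 : ℂ) (1 * 1)) :=
  ⟨differentiableOn_para, fun z hz => by
    rw [one_mul, mem_closedBall_zero_iff]; exact (norm_para_lt_one (mem_ball_zero_iff.1 hz)).le⟩

/-- [bookkeeping] Coupling-independent: `StateCouplingLipschitz` with constant `0`. [folklore] -/
theorem stateCouplingLipschitz_paraScheme (S : Set ℂ) (γ : ℝ) : StateCouplingLipschitz paraScheme S 0 γ := by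
  intro g g' _ _ _ _ x _
  simp [paraScheme]

/-- [bookkeeping] The first step moves the bare state by `1∕3`. [folklore] -/
theorem firstStep_paraScheme (γ : ℝ) : FirstStep paraScheme 0 (1 / 3) γ := by
  intro g _ _
  have h0 : paraScheme g 0 = ((1 / 3 : ℝ) : ℂ) := by
    rw [paraScheme, show (0 : ℂ) = ((0 : ℝ) : ℂ) from Complex.ofReal_zero.symm, para_ofReal]; norm_num
  rw [h0, dist_zero_right, Complex.norm_real, Real.norm_eq_abs, abs_of_pos (by norm_num : (0 : ℝ) < 1 / 3)]

end Para

/-! ## §2 The orbit of the bare state: `n∕(n+2)`, converging polynomially to the boundary fixed point -/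

section Orbit

/-- [bookkeeping] The real recursion: `para (n∕(n+2)) = (n+1)∕(n+3)`. [folklore] -/
theorem para_orbit_step (n : ℕ) : para (((n : ℝ) / ((n : ℝ) + 2) : ℝ) : ℂ) = ((((n : ℝ) + 1) / ((n : ℝ) + 3) : ℝ) : ℂ) := by
  rw [para_ofReal]
  congr 1
  have h2 : (n : ℝ) + 2 ≠ 0 := by positivity
  have h3 : (n : ℝ) + 3 ≠ 0 := by positivity
  have h6 : 2 * (n : ℝ) + 6 ≠ 0 := by positivity
  have e1 : 1 + (n : ℝ) / ((n : ℝ) + 2) = (2 * n + 2) / ((n : ℝ) + 2) := by field_simp; ring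
  have e2 : 3 - (n : ℝ) / ((n : ℝ) + 2) = (2 * n + 6) / ((n : ℝ) + 2) := by field_simp; ring
  rw [e1, e2, div_div_div_cancel_right₀ h2, div_eq_div_iff h6 h3]
  ring

/-- **THE ORBIT OF THE BARE STATE IS `n∕(n+2)`** along every coupling sequence. [folklore] -/
theorem state_paraScheme (g : ℕ → ℝ) : ∀ n, state paraScheme 0 g n = (((n : ℝ) / ((n : ℝ) + 2) : ℝ) : ℂ)
  | 0 => by simp
  | n + 1 => by
    rw [state_succ, state_paraScheme g n, paraScheme, para_orbit_step]
    push_cast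
    ring_nf

/-- The β-family READ OFF the parabolic scheme by `re`. [folklore] -/
def paraBeta : HBeta := fun k v => (state paraScheme 0 (extd v) (k + 1)).re

/-- [bookkeeping] `RepresentsAut paraScheme re 0 γ paraBeta` — by definition. [folklore] -/
theorem representsAut_paraBeta (γ : ℝ) : RepresentsAut paraScheme Complex.re 0 γ paraBeta := fun _ _ _ => rfl

/-- **THE REPRESENTED FAMILY IS `β_{k+1} = (k+1)∕(k+3) = 1 − 2∕(k+3)`** — history-independent, increasing to `1`. [folklore] -/
theorem paraBeta_eq (k : ℕ) (v : Fin (k + 1) → ℝ) : paraBeta k v = 1 - 2 / ((k : ℝ) + 3) := by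
  rw [paraBeta, state_paraScheme, Complex.ofReal_re]
  have h3 : (k : ℝ) + 3 ≠ 0 := by positivity
  push_cast
  field_simp
  ring

end Orbit

/-! ## §3 King's-currency β-input HOLDS: the n-shift modulus `2∕(j+3) → 0`; the family converges -/

section King

/-- **KING's INPUT HOLDS**: `UniformShift (fun j ↦ 2∕(j+3)) γ paraBeta` — the β-function after `j + n` steps differs from the one after `j` steps by at most `2∕(j+3)`,
uniformly in the gap `n` and the history ((R51)'s rate-free n-shift modulus). [folklore] -/
theorem uniformShift_paraBeta (γ : ℝ) : UniformShift (fun j => 2 / ((j : ℝ) + 3)) γ paraBeta := by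
  intro n j g _
  rw [paraBeta_eq, paraBeta_eq]
  have hj : (0 : ℝ) < (j : ℝ) + 3 := by positivity
  have hmono : 2 / (((j + n : ℕ) : ℝ) + 3) ≤ 2 / ((j : ℝ) + 3) := by
    apply div_le_div_of_nonneg_left (by norm_num) hj
    push_cast; linarith
  have hb : 0 ≤ 2 / (((j + n : ℕ) : ℝ) + 3) := by positivity
  rw [show (1 - 2 / (((j + n : ℕ) : ℝ) + 3)) - (1 - 2 / ((j : ℝ) + 3)) = 2 / ((j : ℝ) + 3) - 2 / (((j + n : ℕ) : ℝ) + 3) by ring,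
    abs_of_nonneg (sub_nonneg.2 hmono)]
  linarith

/-- [bookkeeping] … and the modulus tends to `0`: the β-side input of node U2 on King's route, `UniformShift ω` with `ω → 0`, is SATISFIED by the parabolic scheme. [folklore] -/
theorem tendsto_paraOmega : Tendsto (fun j : ℕ => 2 / ((j : ℝ) + 3)) atTop (𝓝 0) := by
  have h : Tendsto (fun j : ℕ => (2 : ℝ) / ((j + 3 : ℕ) : ℝ)) atTop (𝓝 0) :=
    (tendsto_const_div_atTop_nhds_zero_nat (2 : ℝ)).comp (tendsto_add_atTop_nat 3)
  refine Tendsto.congr (fun j => ?_) h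
  push_cast
  ring

/-- [bookkeeping] The family CONVERGES (to `1`) along every history — (R51)'s pointwise input (P) in its strongest, history-free form. [folklore] -/
theorem tendsto_paraBeta (v : (k : ℕ) → (Fin (k + 1) → ℝ)) : Tendsto (fun k => paraBeta k (v k)) atTop (𝓝 1) := by
  have h : Tendsto (fun k : ℕ => (1 : ℝ) - 2 / ((k : ℝ) + 3)) atTop (𝓝 (1 - 0)) := tendsto_const_nhds.sub tendsto_paraOmega
  rw [sub_zero] at h
  exact h.congr fun k => (paraBeta_eq k (v k)).symm

/-- [bookkeeping] The memory companion holds trivially (history-independent family): `HistLipschitz 0 γ paraBeta`. [folklore] -/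
theorem histLipschitz_paraBeta (γ : ℝ) : HistLipschitz (fun _ _ => 0) γ paraBeta := by
  intro k v w _ _
  rw [paraBeta_eq, paraBeta_eq, sub_self, abs_zero]
  simp

end King

/-! ## §4 NE4 FAILS at every geometric rate; no orbit stability on the invariant disc -/

section NoRate

/-- **THE SCALE SHIFT IS POLYNOMIAL**: `β (k+1) w − β k (tail w) = 2∕((k+3)(k+4))`. [folklore] -/
theorem paraBeta_shift (k : ℕ) (w : Fin (k + 2) → ℝ) :
    paraBeta (k + 1) w - paraBeta k (Fin.tail w) = 2 / (((k : ℝ) + 3) * ((k : ℝ) + 4)) := by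
  rw [paraBeta_eq, paraBeta_eq]
  have h3 : (k : ℝ) + 3 ≠ 0 := by positivity
  have h4 : ((k + 1 : ℕ) : ℝ) + 3 ≠ 0 := by positivity
  push_cast
  field_simp
  ring

/-- **NE4 FAILS FOR THE PARABOLIC FAMILY AT EVERY GEOMETRIC RATE** (`γ > 0`, `0 ≤ θ < 1`, all `c`): a polynomial scale shift `2∕((k+3)(k+4))` is not `≤ c·θ^k` for all `k`
(`k²θ^k → 0`).  Every shape of the autonomous road holds (holomorphic self-map of ONE ball, invariant, coupling-independent, 1-Lipschitz read-out, first step 1∕3) EXCEPT the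
margin; King's input holds (§3); NE4 does not. [folklore] -/
theorem not_scaleShiftRate_para {γ θ : ℝ} (hγ : 0 < γ) (hθ0 : 0 ≤ θ) (hθ1 : θ < 1) (c : ℝ) : ¬ ScaleShiftRate c θ γ paraBeta := by
  intro hS
  have hbox : ∀ k, (fun _ : Fin (k + 2) => γ) ∈ Box γ (k + 1) := fun k => mem_box.2 fun _ => ⟨hγ, le_rfl⟩
  have hle : ∀ k : ℕ, 2 / (((k : ℝ) + 3) * ((k : ℝ) + 4)) ≤ c * θ ^ k := fun k => by
    have h := hS k (fun _ => γ) (hbox k)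
    rwa [paraBeta_shift, abs_of_pos (by positivity)] at h
  have hc : 0 < c := by
    have h0 := hle 0
    norm_num at h0
    linarith
  -- k² θ^k → 0
  have ht : Tendsto (fun k : ℕ => (k : ℝ) ^ 2 * θ ^ k) atTop (𝓝 0) :=
    tendsto_pow_const_mul_const_pow_of_abs_lt_one 2 (abs_lt.2 ⟨by linarith, hθ1⟩)
  have hev : ∀ᶠ k : ℕ in atTop, (k : ℝ) ^ 2 * θ ^ k < 1 / (20 * c) :=
    ht.eventually (gt_mem_nhds (by positivity))
  obtain ⟨N, hN⟩ := (hev.and (eventually_ge_atTop 1)).exists_forall_of_atTop.imp fun N h => h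
  have hk := hN N le_rfl
  obtain ⟨hsmall, hN1⟩ := hk
  have hN1' : (1 : ℝ) ≤ N := by exact_mod_cast hN1
  have h1 := hle N
  -- (N+3)(N+4) ≤ 20 N² for N ≥ 1
  have hpoly : ((N : ℝ) + 3) * ((N : ℝ) + 4) ≤ 20 * (N : ℝ) ^ 2 := by nlinarith
  have hprod : 2 ≤ c * θ ^ N * (((N : ℝ) + 3) * ((N : ℝ) + 4)) := by
    have hpos : 0 < ((N : ℝ) + 3) * ((N : ℝ) + 4) := by positivity
    have := (div_le_iff₀ hpos).1 h1
    linarith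
  have hθN : 0 ≤ θ ^ N := pow_nonneg hθ0 N
  have h2 : c * θ ^ N * (((N : ℝ) + 3) * ((N : ℝ) + 4)) ≤ c * θ ^ N * (20 * (N : ℝ) ^ 2) :=
    mul_le_mul_of_nonneg_left hpoly (mul_nonneg hc.le hθN)
  have h3 : c * θ ^ N * (20 * (N : ℝ) ^ 2) = 20 * c * ((N : ℝ) ^ 2 * θ ^ N) := by ring
  have h4 : 20 * c * ((N : ℝ) ^ 2 * θ ^ N) < 20 * c * (1 / (20 * c)) := mul_lt_mul_of_pos_left hsmall (by positivity)
  rw [mul_one_div_cancel (by positivity)] at h4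
  linarith

/-- **NO ORBIT STABILITY ON THE INVARIANT DISC** (`C ≥ 0`, `0 ≤ θ < 1`, `γ > 0`): else (R42)'s `scaleShiftRate_of_stable` would give NE4. [folklore] -/
theorem not_orbitStability_para {γ θ C : ℝ} (hγ : 0 < γ) (hC : 0 ≤ C) (hθ0 : 0 ≤ θ) (hθ1 : θ < 1) :
    ¬ OrbitStability paraScheme (ball (0 : ℂ) 1) C θ γ := fun hst =>
  not_scaleShiftRate_para hγ hθ0 hθ1 (1 * C * (1 / 3) * θ)
    (scaleShiftRate_of_stable (invariant_paraScheme γ) (mem_ball_self one_pos) hst (firstStep_paraScheme γ) hC hθ0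
      zero_le_one (representsAut_paraBeta γ)
      -- the read-out `re` is 1-Lipschitz (= `AutonomousSchemeMargin.readLipschitzOn_re`, inlined to keep this file's imports built)
      (fun x _ x' _ => by rw [one_mul, dist_eq_norm, ← Complex.sub_re]; exact Complex.abs_re_le_norm _))

end NoRate

end Markov

end Summit.QuantumFields.BalabanUV.T4Continuum.Spine.NE4

end
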